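import Literature.Probability.Percolation.HutchcroftVolumeTail
import Literature.Probability.Percolation.SusceptibilityMeanFieldLower
import Literature.Probability.Percolation.PercolationProofs
import Literature.Barriers.CriticalPhenomena.TimarCriticalNonunimodular
import HarnessLib

/-!
# PAPER-2 track, ARM-3 (route C2), part 1/2: the EVENT-AGNOSTIC entropic bound for the cluster exploration, and
# percolation on the lattice restricted to a vertex set (graph, measure, clusters)

builds on p205010 (kernel theorem, internal audit signed; external expert review pending).
Status sentence for p205010: "θ(p_c) = 0 on ℤ^d, all d ≥ 2 — kernel-verified (Lean 4/Mathlib, standard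
axioms); internal adversarial audit SIGNED 2026-08-20 04:29Z; external expert review pending."

Seat `prim-quant-arm-3`, `--supports stmt-CriticalPhenomena-4575`; pure proofs, no definitions.  Part 2
(`…QuantArmEntropicBound.lean`) applies this to the ONE-ARM event `{0 ↔ ∂Λ_R in Λ_R}`; memo
`run/shared/lean/prim/quant/prim-quant-arm-3/POWERLAW-SURVEY.md` §4(C).  The tree's `ClusterExploration.real_clusterSizeGe_le_of_kl`
(Hutchcroft 2022 Thm. 1.3 / Dewan–Muirhead's relative-entropy bound) is written for the volume events `{|C(o)| ≥ n}`; its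
ingredients (generalised Pinsker for the transcript laws, the chain rule `D_KL = kl · E[#queries]`, the revealment bound
`#queries ≤ Δ|A|`) are event-agnostic, and here they are re-assembled for an ARBITRARY predicate of the exploration state:

* `Quant.real_setOf_run_le_of_kl` — `P_q(Φ(run_k)) ≤ 2 P_p(Φ(run_k)) + 8Δ kl(p‖q) E_p|A(run_k)|` (degrees `≤ Δ`, `p,q ∈ (0,1)`);
* `Quant.run_A_subset`, `Quant.run_inter_edgeSet`, `Quant.coe_A_run_eq_openCluster` — the active set stays in any
  adjacency-closed set containing the root; the run only reads edges of `G`; at a halted state below the cap the active set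
  is the whole open cluster;
* `Quant.bondPercolation_restrictTo_eq_map` — percolation on `restrictTo G S` (edges of `G` inside `S`, tree def) is the image of
  percolation on `G` under `ω ↦ ω ∩ E(restrictTo G S)` (`setBernoulli_map_inter`); `Quant.openGraph_inter_edgeSet_restrictTo`,
  `Quant.openCluster_subset_of_subset_edgeSet_restrictTo` — the corresponding identities for open graphs and clusters.
[cite: Hutchcroft2022Triangle, Thm. 4.1 and proof of Thm. 1.3] [cite: DewanMuirhead2022, §2 (the relative-entropy bound)]
-/

noncomputable section

namespace Summit.CriticalPhenomena.PercolationContinuityZ3.Theorems.Quant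

open MeasureTheory Literature.Probability.Percolation Literature.Probability.LatticeModels
open Literature.Probability.Percolation.ClusterExploration Literature.Probability.Entropy
open scoped ENNReal

/-! ### §1. The event-agnostic entropic bound for the cluster exploration -/

section Generic

variable {V : Type*} [DecidableEq V] {G : SimpleGraph V} [G.LocallyFinite] {n : ℕ}

/-- The active set of the exploration stays inside any set containing the root and closed under `G`-adjacency
(every new active vertex is a `G`-neighbour of an active vertex). [folklore] -/
theorem run_A_subset (o : V) (ω : Set (Sym2 V)) (S : Set V) (ho : o ∈ S) (hS : ∀ u v, G.Adj u v → v ∈ S) :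
    ∀ k, (↑(run G n o ω k).A : Set V) ⊆ S
  | 0 => by
    intro v hv
    simp only [run_zero, init, Finset.coe_singleton, Set.mem_singleton_iff] at hv
    exact hv ▸ ho
  | k + 1 => by
    intro v hv
    rw [run_succ] at hv
    by_cases h : Halted G n (run G n o ω k)
    · rw [step_of_halted h] at hv
      exact run_A_subset o ω S ho hS k hv
    · rw [step_of_not_halted h] at hv
      dsimp only [ClusterExploration.extend] at hv
      split_ifs at hv with hb
      · rw [Finset.coe_union, Set.mem_union] at hv
        rcases hv with hv | hv
        · exact run_A_subset o ω S ho hS k hv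
        · rw [Finset.mem_coe, newVerts, Finset.mem_biUnion] at hv
          obtain ⟨u, -, hu⟩ := hv
          rw [Finset.mem_filter, SimpleGraph.mem_neighborFinset] at hu
          exact hS u v hu.1
      · exact run_A_subset o ω S ho hS k hv

/-- **The entropic bound for an arbitrary event of the exploration** (the event-agnostic core of Hutchcroft 2022,
Thm. 4.1 / Dewan–Muirhead's Prop. 2.1): for a graph of degrees `≤ Δ`, `p, q ∈ (0,1)`, any number of steps `k` and
any predicate `Φ` of the state, `P_q(Φ(run_k)) ≤ 2 P_p(Φ(run_k)) + 8 Δ kl(p‖q) E_p[|A(run_k)|]`.  Ingredients (all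
tree theorems): the generalised Pinsker inequality `(a−b)² ≤ 2 D_KL max(a,b)` for the transcript laws
(`sq_sub_le_two_mul_kl_mul_max`), the chain rule `D_KL = kl(p‖q) E_p[#queries]` (`kl_run_eq`), the revealment bound
`#queries ≤ Δ |A|` (`length_hist_run_le`), and the dichotomy `b ≤ 2a ∨ b ≤ 8 D_KL`.
[cite: Hutchcroft2022Triangle, Thm. 4.1 and proof of Thm. 1.3] [cite: DewanMuirhead2022, §2 (the relative-entropy bound)] -/
theorem real_setOf_run_le_of_kl {Δ : ℕ} (hΔ : ∀ v, G.degree v ≤ Δ) (o : V) (p q : unitInterval)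
    (hp0 : 0 < (p : ℝ)) (hp1 : (p : ℝ) < 1) (hq0 : 0 < (q : ℝ)) (hq1 : (q : ℝ) < 1) (k : ℕ)
    (Φ : State V → Prop) [DecidablePred Φ] :
    (bondPercolation G q).real {ω | Φ (run G n o ω k)} ≤
      2 * (bondPercolation G p).real {ω | Φ (run G n o ω k)} +
        8 * Δ * binaryKL p q * ∫ ω, ((run G n o ω k).A.card : ℝ) ∂(bondPercolation G p) := by
  classical
  -- the binary relative entropy is nonnegative
  have hkl0 : 0 ≤ binaryKL p q := by
    have h1 : 1 - (q : ℝ) / p ≤ Real.log (p / q) := by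
      have := Real.log_le_sub_one_of_pos (show 0 < (q : ℝ) / p by positivity)
      rw [Real.log_div hq0.ne' hp0.ne'] at this
      rw [Real.log_div hp0.ne' hq0.ne']
      linarith
    have h2 : 1 - (1 - (q : ℝ)) / (1 - p) ≤ Real.log ((1 - p) / (1 - q)) := by
      have h1p : (0 : ℝ) < 1 - p := by linarith
      have h1q : (0 : ℝ) < 1 - q := by linarith
      have := Real.log_le_sub_one_of_pos (show 0 < (1 - (q : ℝ)) / (1 - p) by positivity)
      rw [Real.log_div h1q.ne' h1p.ne'] at this
      rw [Real.log_div h1p.ne' h1q.ne']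
      linarith
    have h1p : (0 : ℝ) < 1 - p := by linarith
    calc (0 : ℝ) = p * (1 - q / p) + (1 - p) * (1 - (1 - q) / (1 - p)) := by field_simp; ring
      _ ≤ p * Real.log (p / q) + (1 - p) * Real.log ((1 - p) / (1 - q)) :=
          add_le_add (mul_le_mul_of_nonneg_left h1 hp0.le) (mul_le_mul_of_nonneg_left h2 h1p.le)
      _ = binaryKL p q := rfl
  -- the expected active-set size and the revealment bound
  set S : ℝ := ∫ ω, ((run G n o ω k).A.card : ℝ) ∂(bondPercolation G p) with hS
  have hS0 : 0 ≤ S := integral_nonneg fun ω => Nat.cast_nonneg _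
  have hrev : ∫ ω, ((run G n o ω k).hist.length : ℝ) ∂(bondPercolation G p) ≤ Δ * S := by
    rw [hS, ← integral_const_mul]
    refine integral_mono (integrable_comp_run (G := G) (n := n) p o k fun σ => (σ.hist.length : ℝ))
      ((integrable_comp_run (G := G) (n := n) p o k fun σ => (σ.A.card : ℝ)).const_mul _) fun ω => ?_
    have h := length_hist_run_le (G := G) (n := n) o ω k hΔ
    show ((run G n o ω k).hist.length : ℝ) ≤ (Δ : ℝ) * ((run G n o ω k).A.card : ℝ)
    exact_mod_cast h
  -- the chain rule for the relative entropy of the transcripts (before abbreviating)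
  have hKLraw := kl_run_eq (G := G) (n := n) p q hp0 hp1 hq0 hq1 o k
  rw [← binaryKL_def] at hKLraw
  set s := support G n o k with hs
  set P : State V → ℝ := fun σ => (bondPercolation G p).real {ω | run G n o ω k = σ} with hP
  set Q : State V → ℝ := fun σ => (bondPercolation G q).real {ω | run G n o ω k = σ} with hQ
  set A := s.filter Φ with hA
  have ha : (bondPercolation G p).real {ω | Φ (run G n o ω k)} = ∑ σ ∈ A, P σ := real_setOf_run p o k Φ
  have hb : (bondPercolation G q).real {ω | Φ (run G n o ω k)} = ∑ σ ∈ A, Q σ := real_setOf_run q o k Φ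
  -- the generalised Pinsker inequality for the transcript laws
  have hDM := sq_sub_le_two_mul_kl_mul_max s A (Finset.filter_subset _ _) P Q
    (fun σ hσ => real_run_eq_pos hp0 hp1 hσ) (fun σ hσ => real_run_eq_pos hq0 hq1 hσ)
    (sum_real_run_eq p o k) (sum_real_run_eq q o k)
  -- the relative entropy of the transcripts and the revealment bound
  have hKL : ∑ σ ∈ s, P σ * Real.log (P σ / Q σ) ≤ binaryKL p q * (Δ * S) := by
    rw [hKLraw]
    exact mul_le_mul_of_nonneg_left hrev hkl0
  rw [← ha, ← hb] at hDM
  set a := (bondPercolation G p).real {ω | Φ (run G n o ω k)}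
  set b := (bondPercolation G q).real {ω | Φ (run G n o ω k)}
  have ha0 : 0 ≤ a := measureReal_nonneg
  have hb0 : 0 ≤ b := measureReal_nonneg
  set M := binaryKL p q * (Δ * S) with hM
  have hM0 : 0 ≤ M := mul_nonneg hkl0 (mul_nonneg (Nat.cast_nonneg _) hS0)
  have key : (a - b) ^ 2 ≤ 2 * M * max a b :=
    hDM.trans (mul_le_mul_of_nonneg_right (mul_le_mul_of_nonneg_left hKL (by norm_num)) (le_max_of_le_left ha0))
  by_cases h2 : b ≤ 2 * a
  · have : 0 ≤ 8 * (Δ : ℝ) * binaryKL p q * S :=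
      mul_nonneg (mul_nonneg (mul_nonneg (by norm_num) (Nat.cast_nonneg _)) hkl0) hS0
    linarith
  · push Not at h2
    have hmax : max a b = b := max_eq_right (by linarith)
    rw [hmax] at key
    have hb4 : b ≤ 8 * M := by
      have h1 : b ^ 2 / 4 ≤ (a - b) ^ 2 := by nlinarith
      have hbpos : 0 < b := by linarith
      have : b ^ 2 / 4 ≤ 2 * M * b := h1.trans key
      nlinarith
    calc b ≤ 8 * M := hb4
      _ = 8 * Δ * binaryKL p q * S := by rw [hM]; ring
      _ ≤ 2 * a + 8 * Δ * binaryKL p q * S := by linarith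

/-- **At a halted state whose cluster is smaller than the cap, the active set IS the open cluster** (as sets): if
`|C(o)| < n` (`ω ⊆ E(G)`), the run halted with an empty boundary and `A = C(o)`
(`coe_A_subset_openCluster`, `openCluster_subset_of_boundary_eq_empty`). [folklore] -/
theorem coe_A_run_eq_openCluster (o : V) {ω : Set (Sym2 V)} (hω : ω ⊆ G.edgeSet) {k : ℕ}
    (hH : Halted G n (run G n o ω k)) (hlt : (openCluster ω o).encard < n) :
    (↑(run G n o ω k).A : Set V) = openCluster ω o := by
  refine Set.Subset.antisymm (coe_A_subset_openCluster o ω k) ?_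
  rcases hH with hcard | hB
  · exfalso
    have h1 := card_A_le_encard (G := G) (n := n) o ω k
    have h2 : (n : ℕ∞) ≤ ((run G n o ω k).A.card : ℕ∞) := by exact_mod_cast hcard
    exact (lt_irrefl _) ((h2.trans h1).trans_lt hlt)
  · exact openCluster_subset_of_boundary_eq_empty o hω k hB

/-- **The run only reads edges of `G`**: replacing `ω` by `ω ∩ E(G)` does not change the exploration (`run_congr`:
every queried edge is an edge of `G` and its recorded answer is its state in `ω`). [folklore] -/
theorem run_inter_edgeSet (o : V) (ω : Set (Sym2 V)) (k : ℕ) :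
    run G n o (ω ∩ G.edgeSet) k = run G n o ω k := by
  refine run_congr o k fun eb heb => ?_
  have hI := inv_run (G := G) (n := n) o ω k
  have hq : eb.1 ∈ queried (run G n o ω k) := mem_queried_iff.2 ⟨eb.2, heb⟩
  have hE := (hI.queried_spec eb.1 hq).1
  rw [Set.mem_inter_iff, hI.answers eb heb]
  exact ⟨fun h => h.1, fun h => ⟨h, hE⟩⟩

end Generic

/-! ### §2. The lattice restricted to a box: graph, measure and cluster bookkeeping -/

section Restrict

variable {V : Type*} {G : SimpleGraph V}

/-- The restricted graph has fewer edges. [folklore] -/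
theorem edgeSet_restrictTo_subset (G : SimpleGraph V) (S : Set V) : (restrictTo G S).edgeSet ⊆ G.edgeSet :=
  SimpleGraph.edgeSet_subset_edgeSet.2 (restrictTo_le G S)

/-- **Percolation on the restricted graph is the image of percolation on `G` under `ω ↦ ω ∩ E(restrictTo G S)`**
(coordinatewise restriction of a product Bernoulli measure, `setBernoulli_map_inter`). [folklore] -/
theorem bondPercolation_restrictTo_eq_map (G : SimpleGraph V) (S : Set V) (p : unitInterval) :
    bondPercolation (restrictTo G S) p =
      (bondPercolation G p).map (fun ω => ω ∩ (restrictTo G S).edgeSet) := by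
  unfold bondPercolation
  rw [Literature.Barriers.CriticalPhenomena.setBernoulli_map_inter,
    Set.inter_eq_right.2 (edgeSet_restrictTo_subset G S)]

/-- `ω ↦ ω ∩ E` is measurable. [folklore] -/
theorem measurable_inter_const (E : Set (Sym2 V)) : Measurable fun ω : Set (Sym2 V) => ω ∩ E :=
  measurable_set_iff.2 fun e => (measurable_set_mem e).and measurable_const

/-- **Open edges inside `S`**: for a configuration `ω ⊆ E(G)`, the open graph of `ω ∩ E(restrictTo G S)` is the open graph
of `ω` restricted to `S`. [folklore] -/
theorem openGraph_inter_edgeSet_restrictTo {ω : Set (Sym2 V)} (hω : ω ⊆ G.edgeSet) (S : Set V) :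
    openGraph (ω ∩ (restrictTo G S).edgeSet) = restrictTo (openGraph ω) S := by
  ext a b
  simp only [openGraph_adj, restrictTo_adj, Set.mem_inter_iff, SimpleGraph.mem_edgeSet]
  constructor
  · rintro ⟨⟨hab, -, ha, hb⟩, hne⟩
    exact ⟨⟨hab, hne⟩, ha, hb⟩
  · rintro ⟨⟨hab, hne⟩, ha, hb⟩
    exact ⟨⟨hab, (SimpleGraph.mem_edgeSet G).1 (hω hab), ha, hb⟩, hne⟩

/-- A configuration supported on the edges of `restrictTo G S` has all its open clusters through `S` inside `S`
(the endpoint of an open path from a point of `S` lies in `S`). [folklore] -/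
theorem openCluster_subset_of_subset_edgeSet_restrictTo {ω : Set (Sym2 V)} {S : Set V}
    (hω : ω ⊆ (restrictTo G S).edgeSet) {o : V} (ho : o ∈ S) : openCluster ω o ⊆ S := by
  intro y hy
  have hle : openGraph ω ≤ restrictTo G S := by
    intro a b hab
    rw [openGraph_adj] at hab
    exact (SimpleGraph.mem_edgeSet _).1 (hω hab.1)
  obtain ⟨w⟩ := (hy : (openGraph ω).Reachable o y).mono hle
  exact mem_of_walk_restrictTo w ho

end Restrict


end Summit.CriticalPhenomena.PercolationContinuityZ3.Theorems.Quant
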